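import Summits.QuantumFields.YangMills.Theorems.LangevinControlUVOSLegsAtWeakCouplingCDefs
import Literature.MathematicalPhysics.QuantumFieldTheory.MirrorRPHalfPlaneContinuation
import Literature.MathematicalPhysics.QuantumLattice.EuclideanAction
import Mathlib
import HarnessLib

/-!
# Route `F4SubCurvatureDoor`, crux ⟨stmt-QuantumFields-23125⟩ `RationalToGeneral` / parent ⟨23035⟩ `ShortRootRigidity`:
# LINE g16-A «GLOBAL REDUCTION», obligation C1 `JointAnalyticityOffMirrors` — part 1/2: mirror data and coordinate continuations

The route owner's files-only skeleton `HOME ym-idea-3/l16/GlobalReduction.lean` (planner `ym-idea-3` g16) reduces `ShortRootRigidity`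
to `JointAnalyticityOffMirrors → GermToGlobal → GlobalShortRootRigidity`; `GermToGlobal` (C2) is the tree theorem
`F4SubCurvatureDoorGlobalReduction.germToGlobal` (p679234).  This file lands obligation C1 with the Prop SPELLED OUT (no new
definitions): a kernel `K : ℝ⁴ → ℝ` continuous off `0`, bounded outside the unit ball, invariant under the signed permutations
`W(B₄)` (`IsSignedPerm`) and reflection positive across `x₀ = 0` (point masses at positive times, `timeReflection`) is JOINTLY
REAL-ANALYTIC on the open orthants `{∀ i, xᵢ ≠ 0}` (`jointAnalyticityOffMirrors`).

Assembly of three tree theorems, as planned by the owner: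
* §1–§2: `W(B₄)` contains the total inversion, every coordinate mirror `θ_k = ((ℝ ∙ e_k)ᗮ).reflection` and the swaps `(0 k)`
  (`LinearIsometryEquiv.piLpCongrLeft`), so `K` is even, `θ_k`-invariant and — transporting the `x₀`-positivity by the swap and using
  `isMirrorRPKernel_neg_arg_iff` — reflection positive for EVERY coordinate mirror in the tree's `IsMirrorRPKernel` form; continuity off
  `0` plus the bound outside the unit ball give the half-space bounds; hence `IsMirrorRPKernel.exists_halfPlane_continuation`
  (Osterwalder–Schrader / Bernstein–Widder, `MirrorRPHalfPlaneContinuation.lean`) continues every coordinate slice `t ↦ K(t e_k + v)`,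
  `v ⊥ e_k`, holomorphically to `{Re t > 0}` with `‖F t‖ ≤ K((Re t) e_k)` (`coordinate_continuation`);
* §3: at `x` off the mirrors with margin `ℓ = ½ min |xᵢ|`, every coordinate slice through the cube of side `ℓ` is the trace of a function
  holomorphic on `ball 0 ℓ ⊂ ℂ` (`s ↦ F(x_k + s)`, resp. `F(−x_k − s)` by evenness), all bounded by the supremum `M` of `|K|` on the
  compact annulus `{ℓ ≤ ‖y‖ ≤ ‖x‖ + 4ℓ}`; Siciak's cross theorem `exists_holomorphic_extension_of_separately_local_fintype`
  (`CrossTheoremNStrips.lean`) gives one holomorphic `G` on a polydisc, and the chart lemma `analyticAt_of_holomorphic_chart_fintype`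
  (basis `EuclideanSpace.basisFun`) gives `AnalyticAt ℝ K x`.

Mathlib + tree Literature only; THEOREMS ONLY; no `sorry`; standard axioms.  HONEST FRAMING: a support lemma toward the OPEN crux
23125 / 23035 (`--supports stmt-QuantumFields-23125`); obligation C3 `GlobalShortRootRigidity` (THE WALL) is untouched; no crux, rung
of LADDER-YM (`BalabanLadder.ROT`) or mass-gap statement is proved.  Width seat `ym-line-sfw-p2-w4` g19 (cell ym-idea-1, free hands).
[cite: GlimmJaffeQP1987, §6.1 Thm. 6.1.3] [cite: JarnickiPflug2011, Ch. 5]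
-/

set_option autoImplicit false

noncomputable section

namespace Summit.QuantumFields.YangMills.Theorems.F4SubCurvatureDoorGlobalReduction

open scoped Topology InnerProductSpace
open Filter Set Metric
open Literature.MathematicalPhysics.QuantumLattice (timeReflection timeReflection_apply)
open Literature.MathematicalPhysics.QuantumFieldTheory (IsMirrorRPKernel isMirrorRPKernel_neg_arg_iff)
open Summit.QuantumFields.YangMills.Cruxes.OSLegsAtWeakCouplingC.Sketch (IsSignedPerm)

/-! ## §1 Coordinate mirrors, the total inversion and coordinate swaps are signed permutations -/

/-- The unit coordinate vectors have norm one. [folklore] -/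
theorem norm_single_one (k : Fin 4) : ‖(EuclideanSpace.single k (1 : ℝ) : EuclideanSpace ℝ (Fin 4))‖ = 1 := by
  rw [PiLp.norm_single, norm_one]

/-- `⟪x, e_k⟫ = x_k`. [folklore] -/
theorem inner_single_one_right (x : EuclideanSpace ℝ (Fin 4)) (k : Fin 4) :
    ⟪x, EuclideanSpace.single k (1 : ℝ)⟫_ℝ = x k := by
  rw [EuclideanSpace.inner_single_right]; simp

/-- **The reflection in the coordinate mirror `x_k = 0`** (`((ℝ ∙ e_k)ᗮ).reflection`) flips the `k`-th coordinate.
[folklore] -/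
theorem reflection_single_apply (k : Fin 4) (x : EuclideanSpace ℝ (Fin 4)) (i : Fin 4) :
    ((ℝ ∙ (EuclideanSpace.single k (1 : ℝ) : EuclideanSpace ℝ (Fin 4)))ᗮ.reflection x) i =
      if i = k then -x i else x i := by
  set e : EuclideanSpace ℝ (Fin 4) := EuclideanSpace.single k (1 : ℝ) with he
  have hdec : x = x k • e + (x - x k • e) := by abel
  have hperp : x - x k • e ∈ (ℝ ∙ e)ᗮ := by
    rw [Submodule.mem_orthogonal_singleton_iff_inner_right]
    rw [inner_sub_right, inner_smul_right, he, EuclideanSpace.inner_single_left, EuclideanSpace.inner_single_left]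
    simp
  have h1 : (ℝ ∙ e)ᗮ.reflection e = -e := Submodule.reflection_orthogonalComplement_singleton_eq_neg e
  have h2 : (ℝ ∙ e)ᗮ.reflection (x - x k • e) = x - x k • e := Submodule.reflection_mem_subspace_eq_self hperp
  calc ((ℝ ∙ e)ᗮ.reflection x) i = ((ℝ ∙ e)ᗮ.reflection (x k • e + (x - x k • e))) i := by rw [← hdec]
    _ = (x k • (ℝ ∙ e)ᗮ.reflection e + (ℝ ∙ e)ᗮ.reflection (x - x k • e)) i := by rw [map_add, map_smul]
    _ = (x k • (-e) + (x - x k • e)) i := by rw [h1, h2]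
    _ = if i = k then -x i else x i := by
      rw [he]
      by_cases hik : i = k
      · subst hik; simp
      · simp [hik]

/-- The coordinate mirror reflection is a signed permutation. [folklore] -/
theorem isSignedPerm_reflection_single (k : Fin 4) :
    IsSignedPerm ((ℝ ∙ (EuclideanSpace.single k (1 : ℝ) : EuclideanSpace ℝ (Fin 4)))ᗮ.reflection) := by
  intro i
  refine ⟨i, ?_⟩
  by_cases hik : i = k
  · right
    ext j
    rw [reflection_single_apply]
    by_cases hj : j = k
    · subst hj; subst hik; simp
    · simp [hj, hik]
  · left
    ext j
    rw [reflection_single_apply]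
    by_cases hj : j = k
    · subst hj; simp [hik]
    · simp [hj]

/-- The total inversion `x ↦ −x` is a signed permutation. [folklore] -/
theorem isSignedPerm_neg : IsSignedPerm (LinearIsometryEquiv.neg ℝ : EuclideanSpace ℝ (Fin 4) ≃ₗᵢ[ℝ] EuclideanSpace ℝ (Fin 4)) :=
  fun i => ⟨i, Or.inr (by simp)⟩

/-- The coordinate swap `(0 k)` as a linear isometry: `(S x)_i = x_{(0 k) i}`. [folklore] -/
theorem swap_apply (k : Fin 4) (x : EuclideanSpace ℝ (Fin 4)) (i : Fin 4) :
    (LinearIsometryEquiv.piLpCongrLeft 2 ℝ ℝ (Equiv.swap (0 : Fin 4) k) x) i = x (Equiv.swap (0 : Fin 4) k i) := by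
  rw [LinearIsometryEquiv.piLpCongrLeft_apply, Equiv.piCongrLeft'_apply, Equiv.symm_swap]

/-- The coordinate swap `(0 k)` is a signed permutation. [folklore] -/
theorem isSignedPerm_swap (k : Fin 4) : IsSignedPerm (LinearIsometryEquiv.piLpCongrLeft 2 ℝ ℝ (Equiv.swap (0 : Fin 4) k)) := by
  intro i
  refine ⟨Equiv.swap (0 : Fin 4) k i, Or.inl ?_⟩
  ext j
  rw [swap_apply, PiLp.single_apply, PiLp.single_apply]
  by_cases h : Equiv.swap (0 : Fin 4) k j = i
  · rw [if_pos h, if_pos]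
    rw [← h, Equiv.swap_apply_self]
  · rw [if_neg h, if_neg]
    intro h'; apply h; rw [h', Equiv.swap_apply_self]

/-- **The swap `(0 k)` conjugates the time reflection into the `k`-th coordinate mirror**: `θ₀ (S x) = S (θ_k x)`. [folklore] -/
theorem timeReflection_swap (k : Fin 4) (x : EuclideanSpace ℝ (Fin 4)) :
    timeReflection 4 (LinearIsometryEquiv.piLpCongrLeft 2 ℝ ℝ (Equiv.swap (0 : Fin 4) k) x) =
      LinearIsometryEquiv.piLpCongrLeft 2 ℝ ℝ (Equiv.swap (0 : Fin 4) k)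
        ((ℝ ∙ (EuclideanSpace.single k (1 : ℝ) : EuclideanSpace ℝ (Fin 4)))ᗮ.reflection x) := by
  ext j
  rw [timeReflection_apply, swap_apply, swap_apply, reflection_single_apply]
  by_cases hj : j = 0
  · subst hj; simp
  · rw [if_neg hj, if_neg]
    intro h
    apply hj
    have := congrArg (Equiv.swap (0 : Fin 4) k) h
    rwa [Equiv.swap_apply_self, Equiv.swap_apply_right] at this

/-- `θ₀ = ((ℝ ∙ e₀)ᗮ).reflection`. [folklore] -/
theorem timeReflection_eq_reflection_single (x : EuclideanSpace ℝ (Fin 4)) :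
    timeReflection 4 x = ((ℝ ∙ (EuclideanSpace.single (0 : Fin 4) (1 : ℝ) : EuclideanSpace ℝ (Fin 4)))ᗮ.reflection x) := by
  ext j
  rw [timeReflection_apply, reflection_single_apply]

/-! ## §2 From the route's hypotheses to the mirror data of every coordinate hyperplane -/

section MirrorData

variable {K : EuclideanSpace ℝ (Fin 4) → ℝ}

/-- Signed-permutation invariance ⇒ evenness. [folklore] -/
theorem even_of_signedPerm
    (hB : ∀ R : EuclideanSpace ℝ (Fin 4) ≃ₗᵢ[ℝ] EuclideanSpace ℝ (Fin 4), IsSignedPerm R → ∀ x, K (R x) = K x)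
    (x : EuclideanSpace ℝ (Fin 4)) : K (-x) = K x := by
  have h := hB (LinearIsometryEquiv.neg ℝ) isSignedPerm_neg x
  simpa using h

/-- Signed-permutation invariance ⇒ invariance under every coordinate mirror. [folklore] -/
theorem mirror_invariant_of_signedPerm
    (hB : ∀ R : EuclideanSpace ℝ (Fin 4) ≃ₗᵢ[ℝ] EuclideanSpace ℝ (Fin 4), IsSignedPerm R → ∀ x, K (R x) = K x)
    (k : Fin 4) (x : EuclideanSpace ℝ (Fin 4)) :
    K ((ℝ ∙ (EuclideanSpace.single k (1 : ℝ) : EuclideanSpace ℝ (Fin 4)))ᗮ.reflection x) = K x :=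
  hB _ (isSignedPerm_reflection_single k) x

/-- **Reflection positivity across `x₀ = 0` + signed-permutation invariance ⇒ reflection positivity across every coordinate
mirror `x_k = 0`** (in the `IsMirrorRPKernel` form of the tree: transport by the swap `(0 k)`, then the printed-form
conversion `isMirrorRPKernel_neg_arg_iff` and evenness). [cite: GlimmJaffeQP1987, Def. 6.2.1] -/
theorem isMirrorRPKernel_single
    (hB : ∀ R : EuclideanSpace ℝ (Fin 4) ≃ₗᵢ[ℝ] EuclideanSpace ℝ (Fin 4), IsSignedPerm R → ∀ x, K (R x) = K x)
    (hRP : ∀ (m : ℕ) (x : Fin m → EuclideanSpace ℝ (Fin 4)) (c : Fin m → ℝ), (∀ i, 0 < x i 0) →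
        0 ≤ ∑ i, ∑ j, c i * c j * K (timeReflection 4 (x i) - x j))
    (k : Fin 4) : IsMirrorRPKernel (EuclideanSpace.single k (1 : ℝ) : EuclideanSpace ℝ (Fin 4)) K := by
  have heven : (fun x => K (-x)) = K := funext (even_of_signedPerm hB)
  have h := (isMirrorRPKernel_neg_arg_iff (EuclideanSpace.single k (1 : ℝ) : EuclideanSpace ℝ (Fin 4)) K).2 ?_
  · rwa [heven] at h
  intro m p c hp
  -- transport the family by the swap `(0 k)`
  set S := LinearIsometryEquiv.piLpCongrLeft 2 ℝ ℝ (Equiv.swap (0 : Fin 4) k) with hS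
  have hq : ∀ a, 0 < (S (p a)) 0 := by
    intro a
    rw [hS, swap_apply, Equiv.swap_apply_left, ← inner_single_one_right]
    exact hp a
  have h0 := hRP m (fun a => S (p a)) c hq
  refine h0.trans_eq (Finset.sum_congr rfl fun a _ => Finset.sum_congr rfl fun b _ => ?_)
  rw [hS, timeReflection_swap, ← map_sub, hB _ (isSignedPerm_swap k)]

/-- **Half-space bounds**: continuity off `0` and boundedness outside the unit ball bound `K` on every closed half-space
`{t₀ ≤ x_k}`, `t₀ > 0` (the part inside the unit ball is compact and misses `0`). [folklore] -/
theorem slab_bound (hK : ContinuousOn K {x | x ≠ 0}) (hbd : ∃ C : ℝ, ∀ x, 1 ≤ ‖x‖ → |K x| ≤ C) (k : Fin 4)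
    (t₀ : ℝ) (ht₀ : 0 < t₀) :
    ∃ M : ℝ, ∀ x : EuclideanSpace ℝ (Fin 4),
      t₀ ≤ ⟪x, ‖(EuclideanSpace.single k (1 : ℝ) : EuclideanSpace ℝ (Fin 4))‖⁻¹ •
        (EuclideanSpace.single k (1 : ℝ) : EuclideanSpace ℝ (Fin 4))⟫_ℝ → |K x| ≤ M := by
  obtain ⟨C, hC⟩ := hbd
  set A : Set (EuclideanSpace ℝ (Fin 4)) := {x | t₀ ≤ x k} ∩ Metric.closedBall 0 1 with hA
  have hAc : IsCompact A :=
    (isCompact_closedBall (0 : EuclideanSpace ℝ (Fin 4)) 1).of_isClosed_subset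
      ((isClosed_le continuous_const (PiLp.continuous_apply 2 (fun _ : Fin 4 => ℝ) k)).inter Metric.isClosed_closedBall)
      Set.inter_subset_right
  have hA0 : A ⊆ {x | x ≠ 0} := by
    intro x hx h0
    have h1 : t₀ ≤ x k := hx.1
    rw [h0] at h1
    simp at h1
    linarith
  obtain ⟨M₁, hM₁⟩ := hAc.exists_bound_of_continuousOn (hK.mono hA0)
  refine ⟨max M₁ C, fun x hx => ?_⟩
  rw [norm_single_one, inv_one, one_smul, inner_single_one_right] at hx
  by_cases h1 : ‖x‖ ≤ 1
  · have hxA : x ∈ A := ⟨hx, by rwa [Metric.mem_closedBall, dist_zero_right]⟩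
    have := hM₁ x hxA
    rw [Real.norm_eq_abs] at this
    exact this.trans (le_max_left _ _)
  · exact (hC x (le_of_not_ge h1)).trans (le_max_right _ _)

/-- **The one-coordinate holomorphic continuation** (the tree's `IsMirrorRPKernel.exists_halfPlane_continuation` for the mirror
`x_k = 0`): for every `v ⊥ e_k`, `t ↦ K(t e_k + v)` (`t > 0`) is the trace of a function holomorphic on `{Re t > 0}` bounded by
`K((Re t) e_k)`. [cite: GlimmJaffeQP1987, §6.1 Thm. 6.1.3] -/
theorem coordinate_continuation (hK : ContinuousOn K {x | x ≠ 0}) (hbd : ∃ C : ℝ, ∀ x, 1 ≤ ‖x‖ → |K x| ≤ C)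
    (hB : ∀ R : EuclideanSpace ℝ (Fin 4) ≃ₗᵢ[ℝ] EuclideanSpace ℝ (Fin 4), IsSignedPerm R → ∀ x, K (R x) = K x)
    (hRP : ∀ (m : ℕ) (x : Fin m → EuclideanSpace ℝ (Fin 4)) (c : Fin m → ℝ), (∀ i, 0 < x i 0) →
        0 ≤ ∑ i, ∑ j, c i * c j * K (timeReflection 4 (x i) - x j))
    (k : Fin 4) {v : EuclideanSpace ℝ (Fin 4)} (hv : v k = 0) :
    ∃ F : ℂ → ℂ, DifferentiableOn ℂ F {t : ℂ | 0 < t.re} ∧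
      (∀ t : ℝ, 0 < t → F t = ((K (t • EuclideanSpace.single k (1 : ℝ) + v) : ℝ) : ℂ)) ∧
      (∀ t : ℂ, 0 < t.re → ‖F t‖ ≤ K (t.re • EuclideanSpace.single k (1 : ℝ))) := by
  have hn : (EuclideanSpace.single k (1 : ℝ) : EuclideanSpace ℝ (Fin 4)) ≠ 0 := by
    intro h; have := congrArg (fun x : EuclideanSpace ℝ (Fin 4) => x k) h; simp at this
  have hK' : ContinuousOn K ({0}ᶜ : Set (EuclideanSpace ℝ (Fin 4))) := by
    convert hK using 1
    ext y; simp
  have hvn : ⟪v, (EuclideanSpace.single k (1 : ℝ) : EuclideanSpace ℝ (Fin 4))⟫_ℝ = 0 := by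
    rw [inner_single_one_right, hv]
  obtain ⟨F, hFd, hFr, hFb⟩ := IsMirrorRPKernel.exists_halfPlane_continuation hn hK' (even_of_signedPerm hB)
    (slab_bound hK hbd k) (mirror_invariant_of_signedPerm hB k) (isMirrorRPKernel_single hB hRP k) hvn
  refine ⟨F, hFd, fun t ht => ?_, fun t ht => ?_⟩
  · rw [hFr t ht, norm_single_one, inv_one, one_smul]
  · have := hFb t ht
    rwa [norm_single_one, inv_one, one_smul] at this

end MirrorData

end Summit.QuantumFields.YangMills.Theorems.F4SubCurvatureDoorGlobalReduction

end
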